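import Literature.MathematicalPhysics.QuantumFieldTheory.MullerSchiemann1987.MS87CentralAngle
import HarnessLib

/-!
# Müller–Schiemann, *Continuum limit of a hierarchical SU(2) lattice gauge theory in 4 dimensions*
# (CMP 110, 1987): the FIRST-ORDER EXPANSION OF THE SQUARED CENTRAL ANGLE `θ²(w, iy/2)` on the imaginary axis —
# (5.15)/(5.16) p.276 «Re θ² = 2[1 − w₀] − ¼y² + 𝒪(β^{−4α})» (and the shape of (4.60) p.275) PROVED QUANTITATIVELY
# from Proposition 1's `θ² = 4f(η)` (the sibling `MS87CentralAngle`): `|Re θ²(w, it) − (2[1 − w₀] − t²)| ≤ 7((1 − w₀) + t²)²`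

statement-level skeleton of published theorems with citation tags; proofs where landed; nothing here is a claim about the Yang–Mills mass gap

**Citation header (reproduction of PUBLISHED work).** V. F. Müller, J. Schiemann, *Continuum limit of a hierarchical
SU(2) lattice gauge theory in 4 dimensions*, Commun. Math. Phys. **110** (1987) 261–286, doi 10.1007/BF01207367
[MullerSchiemann1987]; (2.13)–(2.14) p.264, (4.60)–(4.61) p.275, (5.15)–(5.16) p.276 (held Project Euclid scan
`paper:url-96df5da18d4c`; displays read by this seat on its own 3× page renders
`run/shared/lean/pub/lit-balaban/lit-balaban-p12/renders-cmp110ms/`).  Lean lane of the lit-balaban YM LIT SWEEP CONTEXT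
row X1 (register level; zero weight for any token of that table); the model is the `d = 4` HIERARCHICAL `SU(2)` gauge
model, NOT lattice Yang–Mills.  Companion of `MS87NonperturbativeBound` (Sect. 5) and `MS87NonperturbativeContributionL`
(Sect. 4), where (5.15)/(5.16) and (4.60) enter as hypotheses: here they are derived from the definition (2.13).

**What the paper prints.** (2.13) p.264: `θ² = θ²(u, z) = 4f(½{1 − u₀ cos z − u₃ sin z})`, `f(η) = η + ⅓η² + (8/45)η³ + …`
(the series of `arcsin²√η`). (5.15)–(5.16) p.276: *«From the definition (2.13) we deduce for |θ_j²| < β^{−2α}, j = 1, 2,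
and |y| < ½κ(β′)^{−α}, Re θ₁² = 2[1 − (uv⁻¹)₀] − ¼y² + 𝒪(β^{−4α}) (5.15), Re θ₂² = 2[1 − v₀] − ¼y² + 𝒪(β^{−4α}) (5.16).»*
(here `θ₁² = θ²(uv⁻¹, (i/2)y)`, `θ₂² = θ²(v, (i/2)y)`, (5.8)–(5.9)). (4.60) p.275: *«Re θ±² = 2[1 − (e^{∓i(x/2)σ₃}v)₀]cosh(y/2)
− (y/2)² + 𝒪(β^{−4α})»*.

**What this file proves (kernel-checked, 0 sorry, standard axioms; no definition, no named fact).** With the sibling's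
`CentralAngle.fC = f`, `etaOf w z = ½{1 − w₀ cos z − w₃ sin z}`, `thetaSq w z = 4f(etaOf w z)`:
* §1 the tail of `f`: `|f(η) − η| ≤ 2|η|²` for `|η| ≤ ½` (`norm_fC_sub_self_le`, from `0 < a_m ≤ 1`), hence
  `|θ² − 4η| ≤ 8|η|²` (`norm_thetaSq_sub_le`);
* §2 elementary bounds for `|t| ≤ 1`: `cosh t − 1 ≤ t²`, `|sinh t| ≤ 2|t|`, `|cosh t − 1 − t²/2| ≤ (5/96)t⁴` (Mathlib's
  `Real.exp_bound`);
* §3 on the imaginary axis `z = it`: `Re η = ½(1 − w₀ cosh t)`, `Im η = −½ w₃ sinh t` (`etaOf_mul_I_re/im`) and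
  `|η|² ≤ ¾((1 − w₀) + t²)²` (`normSq_etaOf_mul_I_le`, using `w₀² + w₃² ≤ 1`);
* §4 **(5.15)/(5.16) QUANTITATIVE** `re_thetaSq_mul_I`: for `(1 − w₀) + t² ≤ ¼`,
  `|Re θ²(w, it) − (2[1 − w₀] − t²)| ≤ 7((1 − w₀) + t²)²`; with `t = y/2` the main term is `2[1 − w₀] − ¼y²` and, in the
  region of (5.15)/(5.16) where `1 − w₀ = 𝒪(β^{−2α})` and `y² = 𝒪(β^{−2α})`, the error is `𝒪(β^{−4α})` as printed; and
  the (4.60)-shaped variant `|Re θ²(w, it) − (2[1 − w₀]cosh t − t²)| ≤ 8((1 − w₀) + t²)²` (`re_thetaSq_mul_I_cosh`).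

**Readings (declared).** (i) `θ²` is the sibling's `thetaSq` (the function `4f(η)` of (2.13), defined where `|η| < 1`;
no branch of `θ` is chosen — only `θ²` occurs in (5.15)/(5.16)). (ii) The print's `𝒪(β^{−4α})` is replaced by the
explicit `7((1 − w₀) + t²)²`; the hypothesis `(1 − w₀) + t² ≤ ¼` replaces «|θ_j²| < β^{−2α}, |y| < ½κ(β′)^{−α}» (for
`β` large both are small). (iii) (4.60) concerns `θ²(v, ±z/2)` after the symmetry (4.54) `θ²(v, ±z/2) =
θ²(e^{∓i(x/2)σ₃}v, ±iy/2)`, i.e. again a value on the imaginary axis; only that shape is addressed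
(`re_thetaSq_mul_I_cosh`), not (4.54) itself (which is the sibling `MS87HeatKernelGroup`'s (2.8)).

**Not claimed.** (4.54), (4.61), (5.17) (they are in the siblings), anything about lattice Yang–Mills or the Clay
problem.
-/

open Complex Finset
open scoped BigOperators

namespace Literature.MathematicalPhysics.QuantumFieldTheory

namespace MullerSchiemann1987

namespace ThetaSqExpansion

open HeatKernel (u0 u3 u0_sq_add_u3_sq_le_one abs_u0_le_one)
open CentralAngle (fC fA fA_zero_one_two norm_fC_term_le summable_fC_term etaOf thetaSq)

/-! ## §1 The tail of `f`: `|f(η) − η| ≤ 2|η|²` for `|η| ≤ ½` -/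

/-- `|f(η) − η| ≤ 2|η|²` for `|η| ≤ ½`: `f(η) − η = Σ_{m≥2} a_m η^m` with `0 < a_m ≤ 1`, so the tail is at most
`|η|²/(1 − |η|)`. [cite: MullerSchiemann1987, (2.13)–(2.15) pp.264–265] -/
theorem norm_fC_sub_self_le {η : ℂ} (hη : ‖η‖ ≤ 1 / 2) : ‖fC η - η‖ ≤ 2 * ‖η‖ ^ 2 := by
  have hη1 : ‖η‖ < 1 := by linarith
  have hs := summable_fC_term hη1
  have hs' : Summable fun n : ℕ => (fA (n + 1) : ℂ) * η ^ (n + 1 + 1) := (summable_nat_add_iff 1).mpr hs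
  have h0 : (fA 0 : ℂ) * η ^ (0 + 1) = η := by rw [fA_zero_one_two.1]; simp
  have hsplit : fC η = η + ∑' n : ℕ, (fA (n + 1) : ℂ) * η ^ (n + 1 + 1) := by
    rw [fC, hs.tsum_eq_zero_add, h0]
  rw [hsplit, add_sub_cancel_left]
  have hg : Summable fun n : ℕ => ‖η‖ ^ (n + 1 + 1) :=
    (summable_geometric_of_lt_one (norm_nonneg _) hη1).comp_injective
      ((add_left_injective 1).comp (add_left_injective 1))
  have hnorm : Summable fun n : ℕ => ‖(fA (n + 1) : ℂ) * η ^ (n + 1 + 1)‖ :=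
    Summable.of_nonneg_of_le (fun _ => norm_nonneg _) (fun n => norm_fC_term_le η (n + 1)) hg
  calc ‖∑' n : ℕ, (fA (n + 1) : ℂ) * η ^ (n + 1 + 1)‖ ≤ ∑' n : ℕ, ‖(fA (n + 1) : ℂ) * η ^ (n + 1 + 1)‖ :=
        norm_tsum_le_tsum_norm hnorm
    _ ≤ ∑' n : ℕ, ‖η‖ ^ (n + 1 + 1) := hnorm.tsum_le_tsum (fun n => norm_fC_term_le η (n + 1)) hg
    _ = ‖η‖ ^ 2 * ∑' n : ℕ, ‖η‖ ^ n := by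
        rw [← tsum_mul_left]; congr 1; funext n; ring
    _ = ‖η‖ ^ 2 * (1 - ‖η‖)⁻¹ := by rw [tsum_geometric_of_lt_one (norm_nonneg _) hη1]
    _ ≤ ‖η‖ ^ 2 * 2 := by
        refine mul_le_mul_of_nonneg_left ?_ (sq_nonneg _)
        rw [inv_le_comm₀ (by linarith) (by norm_num)]; linarith
    _ = 2 * ‖η‖ ^ 2 := by ring

/-- `|θ²(w, z) − 4η(w, z)| ≤ 8|η|²` for `|η| ≤ ½` (`θ² = 4f(η)`). [cite: MullerSchiemann1987, (2.13) p.264] -/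
theorem norm_thetaSq_sub_le (U : Matrix.specialUnitaryGroup (Fin 2) ℂ) {z : ℂ} (hη : ‖etaOf U z‖ ≤ 1 / 2) :
    ‖thetaSq U z - 4 * etaOf U z‖ ≤ 8 * ‖etaOf U z‖ ^ 2 := by
  rw [thetaSq, ← mul_sub, norm_mul, Complex.norm_ofNat]
  linarith [norm_fC_sub_self_le hη]

/-! ## §2 Elementary hyperbolic bounds for `|t| ≤ 1` -/

/-- `cosh t − 1 ≤ t²` for `|t| ≤ 1` (from `|e^x − 1 − x| ≤ x²`). [folklore] -/
private theorem cosh_sub_one_le_sq {t : ℝ} (ht : |t| ≤ 1) : Real.cosh t - 1 ≤ t ^ 2 := by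
  have h1 := Real.abs_exp_sub_one_sub_id_le ht
  have h2 := Real.abs_exp_sub_one_sub_id_le (show |-t| ≤ 1 by rwa [abs_neg])
  rw [Real.cosh_eq]
  have := (abs_le.mp h1).2; have := (abs_le.mp h2).2
  nlinarith

/-- `|sinh t| ≤ 2|t|` for `|t| ≤ 1` (from `|e^x − 1| ≤ 2|x|`). [folklore] -/
private theorem abs_sinh_le {t : ℝ} (ht : |t| ≤ 1) : |Real.sinh t| ≤ 2 * |t| := by
  have h1 := Real.abs_exp_sub_one_le ht
  have h2 := Real.abs_exp_sub_one_le (show |-t| ≤ 1 by rwa [abs_neg])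
  rw [abs_neg] at h2
  rw [Real.sinh_eq, show (Real.exp t - Real.exp (-t)) / 2 = ((Real.exp t - 1) - (Real.exp (-t) - 1)) / 2 by ring,
    abs_div, abs_two]
  have := abs_sub (Real.exp t - 1) (Real.exp (-t) - 1)
  linarith

/-- `|cosh t − 1 − t²/2| ≤ (5/96)t⁴` for `|t| ≤ 1` (Mathlib's `Real.exp_bound` at order 4). [folklore] -/
private theorem abs_cosh_taylor_le {t : ℝ} (ht : |t| ≤ 1) : |Real.cosh t - 1 - t ^ 2 / 2| ≤ 5 / 96 * t ^ 4 := by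
  have h1 := Real.exp_bound ht (show 0 < 4 by norm_num)
  have h2 := Real.exp_bound (show |-t| ≤ 1 by rwa [abs_neg]) (show 0 < 4 by norm_num)
  have hs : ∀ x : ℝ, ∑ m ∈ range 4, x ^ m / m.factorial = 1 + x + x ^ 2 / 2 + x ^ 3 / 6 := by
    intro x
    simp only [Finset.sum_range_succ, Finset.sum_range_zero, Nat.factorial]
    norm_num
  rw [hs] at h1 h2
  have hn : ((4:ℕ).succ : ℝ) / ((4:ℕ).factorial * (4:ℕ)) = 5 / 96 := by norm_num [Nat.factorial]
  rw [hn] at h1 h2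
  rw [abs_neg] at h2
  have e : Real.cosh t - 1 - t ^ 2 / 2 =
      ((Real.exp t - (1 + t + t ^ 2 / 2 + t ^ 3 / 6)) + (Real.exp (-t) - (1 + -t + (-t) ^ 2 / 2 + (-t) ^ 3 / 6))) / 2 := by
    rw [Real.cosh_eq]; ring
  rw [e, abs_div, abs_two]
  have := abs_add_le (Real.exp t - (1 + t + t ^ 2 / 2 + t ^ 3 / 6))
    (Real.exp (-t) - (1 + -t + (-t) ^ 2 / 2 + (-t) ^ 3 / 6))
  have h4 : |t| ^ 4 = t ^ 4 := by rw [← abs_pow, abs_of_nonneg (by positivity)]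
  rw [h4] at h1 h2
  linarith

/-! ## §3 `η(w, it)` on the imaginary axis -/

/-- `Re η(w, it) = ½(1 − w₀ cosh t)` (`cos(it) = cosh t`). [cite: MullerSchiemann1987, (2.13) p.264, (5.16) p.276] -/
theorem etaOf_mul_I_re (U : Matrix.specialUnitaryGroup (Fin 2) ℂ) (t : ℝ) : (etaOf U ((t : ℂ) * I)).re = (1 - u0 U * Real.cosh t) / 2 := by
  rw [etaOf, Complex.cos_mul_I, Complex.sin_mul_I]
  simp [Complex.cosh_ofReal_re, Complex.sinh_ofReal_re, Complex.cosh_ofReal_im, Complex.sinh_ofReal_im]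

/-- `Im η(w, it) = −½ w₃ sinh t` (`sin(it) = i sinh t`). [cite: MullerSchiemann1987, (2.13) p.264, (5.16) p.276] -/
theorem etaOf_mul_I_im (U : Matrix.specialUnitaryGroup (Fin 2) ℂ) (t : ℝ) : (etaOf U ((t : ℂ) * I)).im = -(u3 U * Real.sinh t) / 2 := by
  rw [etaOf, Complex.cos_mul_I, Complex.sin_mul_I]
  simp [Complex.cosh_ofReal_re, Complex.sinh_ofReal_re, Complex.cosh_ofReal_im, Complex.sinh_ofReal_im]

/-- `|η(w, it)|² ≤ ¾((1 − w₀) + t²)²` for `|t| ≤ 1` (`1 − w₀ cosh t = (1 − w₀) − w₀(cosh t − 1)`, `w₃² ≤ 1 − w₀² ≤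
2(1 − w₀)`, `sinh² t ≤ 4t²`). [cite: MullerSchiemann1987, (5.15)–(5.16) p.276] -/
theorem normSq_etaOf_mul_I_le (U : Matrix.specialUnitaryGroup (Fin 2) ℂ) {t : ℝ} (ht : |t| ≤ 1) :
    ‖etaOf U ((t : ℂ) * I)‖ ^ 2 ≤ 3 / 4 * ((1 - u0 U) + t ^ 2) ^ 2 := by
  rw [← Complex.normSq_eq_norm_sq, Complex.normSq_apply, etaOf_mul_I_re, etaOf_mul_I_im]
  have hc0 : 0 ≤ Real.cosh t - 1 := by linarith [Real.one_le_cosh t]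
  have hc1 : Real.cosh t - 1 ≤ t ^ 2 := cosh_sub_one_le_sq ht
  have hsh : |Real.sinh t| ≤ 2 * |t| := abs_sinh_le ht
  have hsh2 : Real.sinh t ^ 2 ≤ 4 * t ^ 2 := by
    have h := mul_self_le_mul_self (abs_nonneg _) hsh
    rw [abs_mul_abs_self] at h
    nlinarith [abs_mul_abs_self t]
  have hu := u0_sq_add_u3_sq_le_one U
  have hu0 := abs_le.mp (abs_u0_le_one U)
  have ha0 : 0 ≤ 1 - u0 U := by linarith [hu0.2]
  have hu3 : u3 U ^ 2 ≤ 2 * (1 - u0 U) := by nlinarith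
  -- re part: 1 - u0 cosh t = (1 - u0) - u0 (cosh t - 1), |…| ≤ (1 - u0) + t²
  have hb : |1 - u0 U * Real.cosh t| ≤ (1 - u0 U) + t ^ 2 := by
    rw [show 1 - u0 U * Real.cosh t = (1 - u0 U) - u0 U * (Real.cosh t - 1) by ring]
    refine (abs_sub _ _).trans ?_
    rw [abs_of_nonneg ha0, abs_mul, abs_of_nonneg hc0]
    have : |u0 U| * (Real.cosh t - 1) ≤ 1 * (Real.cosh t - 1) :=
      mul_le_mul_of_nonneg_right (abs_u0_le_one U) hc0
    linarith
  have hre : (1 - u0 U * Real.cosh t) * (1 - u0 U * Real.cosh t) ≤ ((1 - u0 U) + t ^ 2) * ((1 - u0 U) + t ^ 2) := by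
    have h := mul_self_le_mul_self (abs_nonneg _) hb
    rwa [abs_mul_abs_self] at h
  -- im part
  have him : (u3 U * Real.sinh t) * (u3 U * Real.sinh t) ≤ 8 * ((1 - u0 U) * t ^ 2) := by
    have : u3 U ^ 2 * Real.sinh t ^ 2 ≤ 2 * (1 - u0 U) * (4 * t ^ 2) :=
      mul_le_mul hu3 hsh2 (sq_nonneg _) (by positivity)
    nlinarith
  have hab : (1 - u0 U) * t ^ 2 ≤ ((1 - u0 U) + t ^ 2) * ((1 - u0 U) + t ^ 2) / 4 := by
    nlinarith [sq_nonneg ((1 - u0 U) - t ^ 2)]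
  have e1 : (1 - u0 U * Real.cosh t) / 2 * ((1 - u0 U * Real.cosh t) / 2) =
      (1 - u0 U * Real.cosh t) * (1 - u0 U * Real.cosh t) / 4 := by ring
  have e2 : -(u3 U * Real.sinh t) / 2 * (-(u3 U * Real.sinh t) / 2) =
      (u3 U * Real.sinh t) * (u3 U * Real.sinh t) / 4 := by ring
  rw [e1, e2]
  nlinarith

/-! ## §4 (5.15)/(5.16): `Re θ²(w, it) = 2[1 − w₀] − t² + 𝒪(((1 − w₀) + t²)²)` -/

/-- **(5.16) (and (5.15), the same statement at `w = uv⁻¹`), QUANTITATIVE**: for `w ∈ G` and real `t` with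
`(1 − w₀) + t² ≤ ¼`, `|Re θ²(w, it) − (2[1 − w₀] − t²)| ≤ 7((1 − w₀) + t²)²`.  At `t = y/2` the main term is the printed
`2[1 − w₀] − ¼y²`, and in the region of (5.15)/(5.16) (`1 − w₀ = 𝒪(β^{−2α})`, `y² = 𝒪(β^{−2α})`) the error is the printed
`𝒪(β^{−4α})`. [cite: MullerSchiemann1987, (5.15)–(5.16) p.276] -/
theorem re_thetaSq_mul_I (U : Matrix.specialUnitaryGroup (Fin 2) ℂ) {t : ℝ} (h : (1 - u0 U) + t ^ 2 ≤ 1 / 4) :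
    |(thetaSq U ((t : ℂ) * I)).re - (2 * (1 - u0 U) - t ^ 2)| ≤ 7 * ((1 - u0 U) + t ^ 2) ^ 2 := by
  have hu0 := abs_le.mp (abs_u0_le_one U)
  have ha0 : 0 ≤ 1 - u0 U := by linarith [hu0.2]
  have ht2 : t ^ 2 ≤ 1 / 4 := by linarith
  have ht : |t| ≤ 1 := (sq_le_one_iff_abs_le_one t).mp (by linarith)
  have hs0 : 0 ≤ (1 - u0 U) + t ^ 2 := by positivity
  -- |η|² ≤ ¾ s², hence |η| ≤ ½
  have hη2 := normSq_etaOf_mul_I_le U ht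
  have hηle : ‖etaOf U ((t : ℂ) * I)‖ ≤ 1 / 2 := by
    nlinarith [norm_nonneg (etaOf U ((t : ℂ) * I)), hη2, h, hs0]
  -- A: |Re θ² − Re 4η| ≤ ‖θ² − 4η‖ ≤ 8|η|²
  have hθ := norm_thetaSq_sub_le U hηle
  have hA : |(thetaSq U ((t : ℂ) * I)).re - (4 * etaOf U ((t : ℂ) * I)).re| ≤
      8 * ‖etaOf U ((t : ℂ) * I)‖ ^ 2 := by
    rw [← Complex.sub_re]
    exact (Complex.abs_re_le_norm _).trans hθ
  -- Re 4η = 2 − 2u₀ cosh t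
  have h4re : (4 * etaOf U ((t : ℂ) * I)).re = 2 - 2 * u0 U * Real.cosh t := by
    have : (4 * etaOf U ((t : ℂ) * I)).re = 4 * (etaOf U ((t : ℂ) * I)).re := by
      simp [Complex.mul_re]
    rw [this, etaOf_mul_I_re]; ring
  -- B: |Re 4η − (2(1−u₀) − t²)| ≤ (5/48)t⁴ + (1−u₀)t²
  have hcosh := abs_cosh_taylor_le ht
  have hB : |(4 * etaOf U ((t : ℂ) * I)).re - (2 * (1 - u0 U) - t ^ 2)| ≤
      5 / 48 * t ^ 4 + (1 - u0 U) * t ^ 2 := by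
    rw [h4re]
    have e : (2 - 2 * u0 U * Real.cosh t) - (2 * (1 - u0 U) - t ^ 2) =
        -2 * u0 U * (Real.cosh t - 1 - t ^ 2 / 2) + (1 - u0 U) * t ^ 2 := by ring
    rw [e]
    refine (abs_add_le _ _).trans ?_
    have h1 : |-2 * u0 U * (Real.cosh t - 1 - t ^ 2 / 2)| ≤ 2 * (5 / 96 * t ^ 4) := by
      rw [abs_mul, abs_mul, abs_neg, abs_two]
      have : |u0 U| * |Real.cosh t - 1 - t ^ 2 / 2| ≤ 1 * (5 / 96 * t ^ 4) :=
        mul_le_mul (abs_u0_le_one U) hcosh (abs_nonneg _) zero_le_one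
      linarith
    have h2 : |(1 - u0 U) * t ^ 2| = (1 - u0 U) * t ^ 2 := abs_of_nonneg (by positivity)
    linarith
  have ht4 : t ^ 4 ≤ ((1 - u0 U) + t ^ 2) ^ 2 := by nlinarith [sq_nonneg t]
  have hab : (1 - u0 U) * t ^ 2 ≤ ((1 - u0 U) + t ^ 2) ^ 2 / 4 := by
    nlinarith [sq_nonneg ((1 - u0 U) - t ^ 2)]
  calc |(thetaSq U ((t : ℂ) * I)).re - (2 * (1 - u0 U) - t ^ 2)|
      ≤ |(thetaSq U ((t : ℂ) * I)).re - (4 * etaOf U ((t : ℂ) * I)).re| +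
          |(4 * etaOf U ((t : ℂ) * I)).re - (2 * (1 - u0 U) - t ^ 2)| := abs_sub_le _ _ _
    _ ≤ 8 * ‖etaOf U ((t : ℂ) * I)‖ ^ 2 + (5 / 48 * t ^ 4 + (1 - u0 U) * t ^ 2) := add_le_add hA hB
    _ ≤ 7 * ((1 - u0 U) + t ^ 2) ^ 2 := by nlinarith [hη2, ht4, hab]


/-- **The (4.60)-shaped variant**: `|Re θ²(w, it) − (2[1 − w₀]cosh t − t²)| ≤ 8((1 − w₀) + t²)²` under the same
hypothesis (`2[1 − w₀](cosh t − 1) ≤ 2(1 − w₀)t²` is of second order). [cite: MullerSchiemann1987, (4.60) p.275] -/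
theorem re_thetaSq_mul_I_cosh (U : Matrix.specialUnitaryGroup (Fin 2) ℂ) {t : ℝ} (h : (1 - u0 U) + t ^ 2 ≤ 1 / 4) :
    |(thetaSq U ((t : ℂ) * I)).re - (2 * (1 - u0 U) * Real.cosh t - t ^ 2)| ≤ 8 * ((1 - u0 U) + t ^ 2) ^ 2 := by
  have hu0 := abs_le.mp (abs_u0_le_one U)
  have ha0 : 0 ≤ 1 - u0 U := by linarith [hu0.2]
  have ht : |t| ≤ 1 := (sq_le_one_iff_abs_le_one t).mp (by linarith)
  have h1 := re_thetaSq_mul_I U h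
  have hc0 : 0 ≤ Real.cosh t - 1 := by linarith [Real.one_le_cosh t]
  have hc1 : Real.cosh t - 1 ≤ t ^ 2 := cosh_sub_one_le_sq ht
  have h2 : |(2 * (1 - u0 U) - t ^ 2) - (2 * (1 - u0 U) * Real.cosh t - t ^ 2)| ≤ 2 * ((1 - u0 U) * t ^ 2) := by
    rw [show (2 * (1 - u0 U) - t ^ 2) - (2 * (1 - u0 U) * Real.cosh t - t ^ 2) =
      -(2 * ((1 - u0 U) * (Real.cosh t - 1))) by ring, abs_neg, abs_of_nonneg (by positivity)]
    nlinarith [mul_le_mul_of_nonneg_left hc1 ha0]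
  have hab : (1 - u0 U) * t ^ 2 ≤ ((1 - u0 U) + t ^ 2) ^ 2 / 4 := by
    nlinarith [sq_nonneg ((1 - u0 U) - t ^ 2)]
  calc |(thetaSq U ((t : ℂ) * I)).re - (2 * (1 - u0 U) * Real.cosh t - t ^ 2)|
      ≤ |(thetaSq U ((t : ℂ) * I)).re - (2 * (1 - u0 U) - t ^ 2)| +
          |(2 * (1 - u0 U) - t ^ 2) - (2 * (1 - u0 U) * Real.cosh t - t ^ 2)| := abs_sub_le _ _ _
    _ ≤ 7 * ((1 - u0 U) + t ^ 2) ^ 2 + 2 * ((1 - u0 U) * t ^ 2) := add_le_add h1 h2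
    _ ≤ 8 * ((1 - u0 U) + t ^ 2) ^ 2 := by nlinarith [hab]

end ThetaSqExpansion

end MullerSchiemann1987

end Literature.MathematicalPhysics.QuantumFieldTheory
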